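import Summits.CriticalPhenomena.PercolationContinuityZ3.Theorems.PercNearOneGluingNoHeavyLowerTailEventGluingSharp
import Summits.CriticalPhenomena.PercolationContinuityZ3.Theorems.PercNearOneGluingAdditiveGluingOfAGloc
import HarnessLib

/-!
# Quantitative additive gluing, I: the first-relay form and the explicit gain ledger (every finite weighted graph)

Support file (`--supports stmt-CriticalPhenomena-4575`), seat `prim-quant-p1` (lane QUANT, method = surplus tracking);
builds on p205010 (kernel theorem, internal audit signed; external expert review pending).  No definitions, no named
facts, no sorries; standard axioms.

The tree's crux `AdditiveGluing` reads `μ(o ↔ b) ≥ μ(o ↔ A) − t` whenever `μ(a ↮ b) ≤ t` for all `a ∈ A` (constant `1`, sharp at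
`|A| = 1`).  Tracking the surplus through (GEN) ⇒ (AG-loc) ⇒ AdditiveGluing shows exactly what the last two arrows discard.  With the
first-in-rank patterns `P_a := {o ↔ a} ∩ ⋂_{r a' < r a} {o ↮ a'}` of a reliability-compatible injective rank `r` (they partition `{o ↔ A}`,
`Σ_a μ(P_a) = μ(o ↔ A)`), and `t_a := μ(a ↮ b) = 1 − μ(a ↔ b)`:

* `agloc_firstRank_holds` — (AG-loc) UNCONDITIONALLY, for every weight function (degenerate weights included):
  `μ({o ↔ A} ∩ {o ↮ b}) ≤ Σ_{a ∈ A} μ(P_a)·t_a`  (the tree had it as the hypothesis of `AGloc.additiveGluing_of_agloc_firstRank` and,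
  through `EventGluingSharp.gen_holds`, implicitly inside `jointGluing_holds`; here it is a named theorem);
* `firstRelayGluing` — the FIRST-RELAY form of additive gluing: `μ(o ↔ A) − Σ_a μ(P_a)·t_a + μ({o ↮ A} ∩ {o ↔ b}) ≤ μ(o ↔ b)`,
  i.e. the loss is the unreliability of the FIRST relay met (averaged), not the worst one, and the off-`A` connections are kept;
* `additiveGluing_gain` — the crux with its explicit gain: for `0 ≤ t` with `t_a ≤ t` on `A`,
  `μ(o ↔ A) − t + ( t·μ(o ↮ A) + Σ_a μ(P_a)·(t − t_a) + μ({o ↮ A} ∩ {o ↔ b}) ) ≤ μ(o ↔ b)`.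
  The only part of the total slack `μ(o ↔ b) − (μ(o ↔ A) − t)` NOT captured is the (AG-loc) surplus
  `Sur := Σ_a μ(P_a)·t_a − μ({o ↔ A} ∩ {o ↮ b}) ≥ 0`, whose infimum over graphs is `0` (attained whenever every relay met first separates
  `o` from `b`; seat census 2026-08-20: 17 302 non-trivial exact equality instances among 154 946 placements on all graphs with ≤ 6
  vertices at `p = 1/2`).  So along the gluing link the quantitative content is: linear in the slacks, first-relay weights, constant 1.
[cite: KozmaNitzan2024, Conj. 1 and display (3) (p. 3), Conj. 4 (p. 32)]
-/

noncomputable section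

namespace Summit.CriticalPhenomena.PercolationContinuityZ3.Theorems

open MeasureTheory Set
open Literature.Probability.LatticeModels (prodBernoulli)
open Literature.Probability.Percolation
open scoped Classical

namespace QuantGluing

variable {n : ℕ}

/-- **(AG-loc) on every finite weighted graph** (first-in-rank form, all weights): for an injective rank `r` on `A` compatible with
`a ↦ μ(a ↔ b)` (less reliable relays first),
`μ({o ↔ A} ∩ {o ↮ b}) ≤ Σ_{a ∈ A} μ({o ↔ a} ∩ ⋂_{r a' < r a} {o ↮ a'}) · (1 − μ(a ↔ b))`.
`EventGluingSharp.gen_holds` fed into `AGloc.agloc_firstRank_of_gen`. [cite: KozmaNitzan2024, Conj. 4 (p. 32)] -/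
theorem agloc_firstRank_holds (w : Sym2 (Fin n) → unitInterval) (A : Finset (Fin n)) (o b : Fin n) (r : Fin n → ℕ)
    (hr : Set.InjOn r ↑A)
    (hcompat : ∀ a ∈ A, ∀ a' ∈ A, r a < r a' →
      (prodBernoulli w).real (openConn a b) ≤ (prodBernoulli w).real (openConn a' b)) :
    (prodBernoulli w).real ((⋃ a ∈ A, openConn o a) ∩ (openConn o b)ᶜ : Set (BondConfig (Fin n))) ≤
      ∑ a ∈ A, (prodBernoulli w).real
          (openConn o a ∩ ⋂ a' ∈ A.filter (fun a' => r a' < r a), (openConn o a')ᶜ : Set (BondConfig (Fin n))) *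
        (1 - (prodBernoulli w).real (openConn a b)) :=
  AGloc.agloc_firstRank_of_gen A.card (fun n' w' A' o' F r' _ hF hF0 hr' hc' =>
      EventGluingSharp.gen_holds n' w' A' o' F r' hF hF0 hr' hc') n w A o b r le_rfl hr hcompat

/-- **First-relay gluing** (all weights): with `P_a` the first-in-rank patterns of a reliability-compatible injective rank,
`μ(o ↔ A) − Σ_a μ(P_a)·(1 − μ(a ↔ b)) + μ({o ↮ A} ∩ {o ↔ b}) ≤ μ(o ↔ b)`.
Identity `μ(o ↔ b) = μ({o ↔ A} ∩ {o ↔ b}) + μ({o ↮ A} ∩ {o ↔ b})`, `μ({o ↔ A} ∩ {o ↔ b}) = μ(o ↔ A) − μ({o ↔ A} ∩ {o ↮ b})`,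
and `agloc_firstRank_holds`. [cite: KozmaNitzan2024, Conj. 1 (p. 3)] -/
theorem firstRelayGluing (w : Sym2 (Fin n) → unitInterval) (A : Finset (Fin n)) (o b : Fin n) (r : Fin n → ℕ)
    (hr : Set.InjOn r ↑A)
    (hcompat : ∀ a ∈ A, ∀ a' ∈ A, r a < r a' →
      (prodBernoulli w).real (openConn a b) ≤ (prodBernoulli w).real (openConn a' b)) :
    (prodBernoulli w).real (⋃ a ∈ A, openConn o a) -
        ∑ a ∈ A, (prodBernoulli w).real
            (openConn o a ∩ ⋂ a' ∈ A.filter (fun a' => r a' < r a), (openConn o a')ᶜ : Set (BondConfig (Fin n))) *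
          (1 - (prodBernoulli w).real (openConn a b)) +
        (prodBernoulli w).real ((⋃ a ∈ A, openConn o a)ᶜ ∩ openConn o b : Set (BondConfig (Fin n))) ≤
      (prodBernoulli w).real (openConn o b) := by
  set μ := prodBernoulli w with hμ
  have hmeas : ∀ S : Set (BondConfig (Fin n)), MeasurableSet S := fun S => (Set.toFinite S).measurableSet
  have hag := agloc_firstRank_holds w A o b r hr hcompat
  rw [← hμ] at hag
  -- `μ(U) = μ(U ∩ B) + μ(U ∩ Bᶜ)` with `U = {o ↔ A}`, `B = {o ↔ b}`
  have hU : μ.real (⋃ a ∈ A, openConn o a) =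
      μ.real ((⋃ a ∈ A, openConn o a) ∩ openConn o b : Set (BondConfig (Fin n))) +
        μ.real ((⋃ a ∈ A, openConn o a) ∩ (openConn o b)ᶜ : Set (BondConfig (Fin n))) := by
    rw [← measureReal_inter_add_sdiff (s := ⋃ a ∈ A, (openConn o a : Set (BondConfig (Fin n)))) (h := measure_ne_top _ _)
      (hmeas (openConn o b)), Set.sdiff_eq]
  -- `μ(B) = μ(B ∩ U) + μ(B ∩ Uᶜ)`
  have hB : μ.real (openConn o b) =
      μ.real ((⋃ a ∈ A, openConn o a) ∩ openConn o b : Set (BondConfig (Fin n))) +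
        μ.real ((⋃ a ∈ A, openConn o a)ᶜ ∩ openConn o b : Set (BondConfig (Fin n))) := by
    rw [← measureReal_inter_add_sdiff (s := (openConn o b : Set (BondConfig (Fin n)))) (h := measure_ne_top _ _)
      (hmeas (⋃ a ∈ A, openConn o a)), Set.sdiff_eq, Set.inter_comm (openConn o b : Set (BondConfig (Fin n))),
      Set.inter_comm (openConn o b : Set (BondConfig (Fin n)))]
  linarith [hag, hU, hB]

/-- **Additive gluing with its explicit gain** (all weights): if `0 ≤ t` and `μ(a ↮ b) ≤ t` for every `a ∈ A` then, with `P_a` the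
first-in-rank patterns of a reliability-compatible injective rank,
`μ(o ↔ A) − t + ( t·μ(o ↮ A) + Σ_a μ(P_a)·(t − μ(a ↮ b)) + μ({o ↮ A} ∩ {o ↔ b}) ) ≤ μ(o ↔ b)`;
each of the three gain terms is nonnegative, and dropping them is the tree's `AdditiveGluing`.  From `firstRelayGluing` and
`Σ_a μ(P_a) = μ(o ↔ A)` (`AGloc.sum_measureReal_firstRank`). [cite: KozmaNitzan2024, Conj. 1 (p. 3)] -/
theorem additiveGluing_gain (w : Sym2 (Fin n) → unitInterval) (A : Finset (Fin n)) (o b : Fin n) (r : Fin n → ℕ)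
    (hr : Set.InjOn r ↑A)
    (hcompat : ∀ a ∈ A, ∀ a' ∈ A, r a < r a' →
      (prodBernoulli w).real (openConn a b) ≤ (prodBernoulli w).real (openConn a' b))
    (t : ℝ) :
    (prodBernoulli w).real (⋃ a ∈ A, openConn o a) - t +
        (t * (prodBernoulli w).real (⋃ a ∈ A, openConn o a : Set (BondConfig (Fin n)))ᶜ +
          ∑ a ∈ A, (prodBernoulli w).real
              (openConn o a ∩ ⋂ a' ∈ A.filter (fun a' => r a' < r a), (openConn o a')ᶜ : Set (BondConfig (Fin n))) *
            (t - (1 - (prodBernoulli w).real (openConn a b))) +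
          (prodBernoulli w).real ((⋃ a ∈ A, openConn o a)ᶜ ∩ openConn o b : Set (BondConfig (Fin n)))) ≤
      (prodBernoulli w).real (openConn o b) := by
  set μ := prodBernoulli w with hμ
  have hmeas : ∀ S : Set (BondConfig (Fin n)), MeasurableSet S := fun S => (Set.toFinite S).measurableSet
  have hfr := firstRelayGluing w A o b r hr hcompat
  rw [← hμ] at hfr
  have hsum := AGloc.sum_measureReal_firstRank w A r o hr
  rw [← hμ] at hsum
  have hcompl : μ.real (⋃ a ∈ A, openConn o a : Set (BondConfig (Fin n)))ᶜ = 1 - μ.real (⋃ a ∈ A, openConn o a) :=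
    probReal_compl_eq_one_sub (hmeas _)
  -- expand the weighted sum `Σ μ(P_a)(t − (1 − m_a)) = t Σ μ(P_a) − Σ μ(P_a)(1 − m_a)`
  have hexp : ∑ a ∈ A, μ.real
        (openConn o a ∩ ⋂ a' ∈ A.filter (fun a' => r a' < r a), (openConn o a')ᶜ : Set (BondConfig (Fin n))) *
        (t - (1 - μ.real (openConn a b))) =
      t * ∑ a ∈ A, μ.real
          (openConn o a ∩ ⋂ a' ∈ A.filter (fun a' => r a' < r a), (openConn o a')ᶜ : Set (BondConfig (Fin n))) -
        ∑ a ∈ A, μ.real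
            (openConn o a ∩ ⋂ a' ∈ A.filter (fun a' => r a' < r a), (openConn o a')ᶜ : Set (BondConfig (Fin n))) *
          (1 - μ.real (openConn a b)) := by
    rw [Finset.mul_sum, ← Finset.sum_sub_distrib]
    refine Finset.sum_congr rfl fun a _ => ?_
    ring
  rw [hexp, hsum, hcompl]
  linarith [hfr]

/-- The three gain terms are nonnegative under the hypotheses of the crux (`0 ≤ t`, `μ(a ↮ b) ≤ t` on `A`), so `additiveGluing_gain`
specialises to the tree's `AdditiveGluing` `μ(o ↔ A) − t ≤ μ(o ↔ b)` — a consistency check, no new content.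
[cite: KozmaNitzan2024, Conj. 1 (p. 3)] -/
theorem additiveGluing_of_gain (w : Sym2 (Fin n) → unitInterval) (A : Finset (Fin n)) (o b : Fin n) (t : ℝ) (ht0 : 0 ≤ t)
    (ht : ∀ a ∈ A, 1 - t ≤ (prodBernoulli w).real (openConn a b)) :
    (prodBernoulli w).real (⋃ a ∈ A, openConn o a) - t ≤ (prodBernoulli w).real (openConn o b) := by
  obtain ⟨r, hr, hrc⟩ := AGloc.exists_rank_compat A (fun a => (prodBernoulli w).real (openConn a b))
  have h := additiveGluing_gain w A o b r hr hrc t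
  have h1 : 0 ≤ t * (prodBernoulli w).real (⋃ a ∈ A, openConn o a : Set (BondConfig (Fin n)))ᶜ :=
    mul_nonneg ht0 measureReal_nonneg
  have h2 : 0 ≤ ∑ a ∈ A, (prodBernoulli w).real
        (openConn o a ∩ ⋂ a' ∈ A.filter (fun a' => r a' < r a), (openConn o a')ᶜ : Set (BondConfig (Fin n))) *
      (t - (1 - (prodBernoulli w).real (openConn a b))) :=
    Finset.sum_nonneg fun a ha => mul_nonneg measureReal_nonneg (by linarith [ht a ha])
  have h3 : 0 ≤ (prodBernoulli w).real ((⋃ a ∈ A, openConn o a)ᶜ ∩ openConn o b : Set (BondConfig (Fin n))) :=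
    measureReal_nonneg
  linarith

end QuantGluing

end Summit.CriticalPhenomena.PercolationContinuityZ3.Theorems

end
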